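import Literature.AlgebraicGeometry.Resolution.AlterationsDimension
import Mathlib.AlgebraicGeometry.Morphisms.FiniteType
import HarnessLib

/-!
# Dimension of a model (crux `FrobeniusLadder.FRationalResolution`, line `Sketch`)

Stub `topologicalKrullDim_eq_of_model` of the skeleton `Sketch` for crux
stmt-ResolutionOfSingularities-15317: if `π : X' → X` is a morphism locally of finite type between
integral schemes, `X` locally of finite type over a field `k`, and `π` is an isomorphism over a
non-empty open `U ⊆ X`, then `dim X' = dim X`.

Proof: `π⁻¹(U)` is a non-empty open of the integral `k`-scheme `X'` (locally of finite type over `k`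
by composition), so `dim X' = dim π⁻¹(U)` (Görtz–Wedhorn I, Thm. 5.22 (3),
`Literature.AlgebraicGeometry.Resolution.topologicalKrullDim_opens_eq`); and
`π⁻¹(U) ≅ U ⊆ X` is an open immersion into `X`, so `dim π⁻¹(U) = dim X`
(`Literature.AlgebraicGeometry.Resolution.topologicalKrullDim_eq_of_isOpenImmersion`).
-/

set_option linter.dupNamespace false

noncomputable section

namespace Summit.ResolutionOfSingularities.ResolutionOfSingularities.Theorems.FRationalResolution

open CategoryTheory AlgebraicGeometry TopologicalSpace
open Literature.AlgebraicGeometry.Resolution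

/-- **A model isomorphic over a non-empty open has the same dimension.** If `π : X' → X` is locally
of finite type between integral schemes, `X` is locally of finite type over a field `k`, and `π`
restricts to an isomorphism `π⁻¹(U) ≅ U` over a non-empty open `U ⊆ X`, then `dim X' = dim X`:
both equal `dim π⁻¹(U)`, by invariance of the dimension of a variety under passing to a non-empty
open subscheme (Görtz–Wedhorn I, Thm. 5.22 (3)). -/
theorem topologicalKrullDim_eq_of_model (k : Type) [Field k] (X X' : Scheme.{0}) [IsIntegral X]
    [IsIntegral X'] (f : X ⟶ Spec (.of k)) [LocallyOfFiniteType f] (π : X' ⟶ X)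
    [LocallyOfFiniteType π] (U : X.Opens) (hUne : (U : Set X).Nonempty) (hiso : IsIso (π ∣_ U)) :
    topologicalKrullDim X' = topologicalKrullDim X := by
  haveI := hiso
  -- the preimage `π⁻¹(U)` is non-empty: pull a point of `U` back along the isomorphism `π ∣_ U`
  have hne' : ((π ⁻¹ᵁ U : X'.Opens) : Set X').Nonempty := by
    obtain ⟨u, hu⟩ := hUne
    let y : ↥(π ⁻¹ᵁ U) := (inv (π ∣_ U)).base ⟨u, hu⟩
    exact ⟨y.1, y.2⟩
  haveI : Nonempty (↑(π ⁻¹ᵁ U) : Scheme.{0}) := hne'.to_subtype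
  rw [← topologicalKrullDim_opens_eq (π ≫ f) (π ⁻¹ᵁ U) hne']
  exact topologicalKrullDim_eq_of_isOpenImmersion f ((π ∣_ U) ≫ U.ι)

end Summit.ResolutionOfSingularities.ResolutionOfSingularities.Theorems.FRationalResolution

end
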